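import Mathlib
import HarnessLib
import Summits.Ventures.LatticeQCDFlow.Scoring.AllPairsAcceptanceCeilingFree
import Summits.Ventures.LatticeQCDFlow.Scoring.SelfNormalisedReweightingConsistency
import Summits.Ventures.LatticeQCDFlow.Scoring.UStatisticStrongLaw

/-!
# The acceptance column at `ε = 0`: the all-pairs acceptance estimate and the PRINTED acceptance
# ratio of one growing proposal stream converge almost surely to the mean Metropolis acceptance
# `acc(p, q)` — with NO hypothesis on the model beyond `q > 0` (the ESS may be `0`)

HONEST FRAMING: exact (Metropolis-corrected) sampling algorithms for lattice gauge theory;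
figures of merit are autocorrelation/cost numbers at stated couplings and volumes; no
continuum-physics claim.

Venture `LatticeQCDFlow` (cell pub-lqcd), topic `Scoring`; FANOUT row 4 (`s0-u1-b`, rung S0-B).
A flow code holds UNNORMALISED weights `w̃ = c·w`, `w = p/q` (`c = Z` unknown) on its proposals
`y₀, y₁, …` (independent, laws `ν = q dμ`) and prints the scale-free acceptance ratio
`Rₙ = Ûₙ/W̄ₙ`, `Ûₙ = Σ_{i ≠ j < n} min(w̃ᵢ, w̃ⱼ)/(n(n − 1))`, `W̄ₙ = Σ_{j<n} w̃ⱼ/n`, whose population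
counterpart is the mean Metropolis acceptance of the independence sampler,
`acc(p, q) = ∫∫ min(p(a)q(b), p(b)q(a)) dμ dμ = E_{q⊗q} min(w, w′)`.  Row 4's certificates for this
column are RATE statements along the moment ladder (`Scoring/AllPairsAcceptanceRatioCeilingFree`:
second moment; `…/AllPairsAcceptanceRatioHeavyTail`: a `(1 + ε)`-th); the `ε = 0` rung here needs
NOTHING: the kernel `min(w, w′)` is square-integrable under the model pair law for EVERY model
(`min(w, w′)² ≤ w·w′`, row 3's `AllPairsVariance.memLp_pairMin_two`), so the U-statistic strong law
of the previous file (`CardConsistency.ustat₂_tendsto_ae`) applies with no moment hypothesis, and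
`W̄ₙ → 1` needs only `∫ p = 1` (`CardConsistency.meanWeight_tendsto_one_ae`).  NEW WORK of the cell
(elementary); no definition is introduced; nothing is cited as a fact.

## Content (`ν = μ.withDensity q`; `w = p/q`; `acc = ∫∫ min(p(a)q(b), p(b)q(a)) dμ dμ`;
## stream `y : ℕ → Ω → X` independent with laws `ν`)

* **`allPairsAcceptance_tendsto_ae`** — `Ûₙ(w) → acc` almost surely (no moment hypothesis);
* `allPairsAcceptance_unnormalised_tendsto_ae` — `Ûₙ(w̃) → c·acc` (`c ≥ 0`);
* `meanWeight_fin_tendsto_one_ae` — `W̄ₙ → 1` with the `Fin n`-indexed sum;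
* **`printedAcceptance_tendsto_ae`** — THE PRINTED RATIO: `Rₙ = Ûₙ(w̃)/W̄ₙ(w̃) → acc` almost
  surely, any `c > 0`, inputs `p ≥ 0`, `∫ p = 1`, `q > 0`, `∫ q < ∞` only.

NOT CLAIMED: any rate (the files above); the chain-side acceptance record of the sampler itself
(`Scoring/IMHAcceptanceRecord*` are the chain-side files); any number of ours re-scored.
-/

noncomputable section

namespace Summit.Ventures.LatticeQCDFlow.Scoring.CardConsistency

open MeasureTheory ProbabilityTheory Finset Real Filter
open scoped Topology Function

section Model

variable {Ω : Type*} [MeasurableSpace Ω] {P : Measure Ω} [IsProbabilityMeasure P]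
variable {X : Type*} [MeasurableSpace X] {μ : Measure X} [SFinite μ] {p q : X → ℝ}
variable {y : ℕ → Ω → X}

/-- **THE ALL-PAIRS ACCEPTANCE ESTIMATE IS STRONGLY CONSISTENT, for every model.**  One independent
proposal stream `yᵢ` (laws `μ.withDensity q`); `p ≥ 0` measurable, integrable, `∫ p dμ = 1`;
`q > 0` measurable, integrable.  Then almost surely
`Ûₙ = Σ_{i ≠ j < n} min(w(yᵢ), w(yⱼ))/(n(n − 1)) → acc(p, q) = ∫∫ min(p(a)q(b), p(b)q(a)) dμ dμ` —
no second weight moment (the ESS may be `0`), no ceiling. [ours] -/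
theorem allPairsAcceptance_tendsto_ae (hym : ∀ j, Measurable (y j)) (hind : iIndepFun y P)
    (hlaw : ∀ j, Measure.map (y j) P = μ.withDensity fun z => ENNReal.ofReal (q z))
    (hp0 : ∀ z, 0 ≤ p z) (hpm : Measurable p) (hpi : Integrable p μ) (hq0 : ∀ z, 0 < q z)
    (hqm : Measurable q) (hqi : Integrable q μ) :
    ∀ᵐ ω ∂P, Tendsto (fun n : ℕ =>
        (∑ z ∈ (univ : Finset (Fin n)).offDiag,
            min (p (y z.1 ω) / q (y z.1 ω)) (p (y z.2 ω) / q (y z.2 ω))) / (n * (n - 1) : ℝ))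
      atTop (𝓝 (∫ a, ∫ b, min (p a * q b) (p b * q a) ∂μ ∂μ)) := by
  have h := ustat₂_tendsto_ae (P := P) (ν := μ.withDensity fun z => ENNReal.ofReal (q z)) hym
    hind hlaw (F := fun a b => min (p a / q a) (p b / q b)) (PairedDraws.measurable_pairMin hpm hqm)
    (fun a b => min_comm _ _) (AllPairsVariance.memLp_pairMin_two hp0 hpm hpi hq0 hqm)
  rw [AllPairsVariance.integral_pairMin_withDensity_eq_meanAccept hp0 hpm hpi hq0 hqm hqi] at h
  exact h

/-- **With unnormalised weights** `w̃ = c·p/q`, `c ≥ 0`: `Ûₙ(w̃) → c·acc` almost surely. [ours] -/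
theorem allPairsAcceptance_unnormalised_tendsto_ae (hym : ∀ j, Measurable (y j))
    (hind : iIndepFun y P)
    (hlaw : ∀ j, Measure.map (y j) P = μ.withDensity fun z => ENNReal.ofReal (q z))
    (hp0 : ∀ z, 0 ≤ p z) (hpm : Measurable p) (hpi : Integrable p μ) (hq0 : ∀ z, 0 < q z)
    (hqm : Measurable q) (hqi : Integrable q μ) {wt : X → ℝ} {c : ℝ} (hc : 0 ≤ c)
    (hwt : ∀ z, wt z = c * (p z / q z)) :
    ∀ᵐ ω ∂P, Tendsto (fun n : ℕ =>
        (∑ z ∈ (univ : Finset (Fin n)).offDiag, min (wt (y z.1 ω)) (wt (y z.2 ω)))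
          / (n * (n - 1) : ℝ))
      atTop (𝓝 (c * ∫ a, ∫ b, min (p a * q b) (p b * q a) ∂μ ∂μ)) := by
  filter_upwards [allPairsAcceptance_tendsto_ae hym hind hlaw hp0 hpm hpi hq0 hqm hqi] with ω hω
  have e : (fun n : ℕ =>
      (∑ z ∈ (univ : Finset (Fin n)).offDiag, min (wt (y z.1 ω)) (wt (y z.2 ω)))
        / (n * (n - 1) : ℝ))
      = fun n : ℕ => c * ((∑ z ∈ (univ : Finset (Fin n)).offDiag,
          min (p (y z.1 ω) / q (y z.1 ω)) (p (y z.2 ω) / q (y z.2 ω))) / (n * (n - 1) : ℝ)) := by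
    funext n
    rw [mul_div_assoc', Finset.mul_sum]
    congr 1
    exact Finset.sum_congr rfl fun z _ => by rw [hwt, hwt, mul_min_of_nonneg _ _ hc]
  rw [e]
  exact hω.const_mul c

omit [IsProbabilityMeasure P] [SFinite μ] in
/-- `W̄ₙ → 1` almost surely, with the `Fin n`-indexed sum of the printed ratio. [ours] -/
theorem meanWeight_fin_tendsto_one_ae (hym : ∀ j, Measurable (y j)) (hind : iIndepFun y P)
    (hlaw : ∀ j, Measure.map (y j) P = μ.withDensity fun z => ENNReal.ofReal (q z))
    (hpm : Measurable p) (hpi : Integrable p μ) (hp1 : ∫ z, p z ∂μ = 1) (hq0 : ∀ z, 0 < q z)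
    (hqm : Measurable q) :
    ∀ᵐ ω ∂P, Tendsto (fun n : ℕ => (∑ j : Fin n, p (y j ω) / q (y j ω)) / n) atTop (𝓝 1) := by
  filter_upwards [meanWeight_tendsto_one_ae hym hind hlaw hpm hpi hp1 hq0 hqm] with ω hω
  refine hω.congr' (Eventually.of_forall fun n => ?_)
  rw [← Fin.sum_univ_eq_sum_range (fun i => p (y i ω) / q (y i ω)) n]

/-- **THE PRINTED ACCEPTANCE RATIO IS STRONGLY CONSISTENT, for every model.**  One independent
proposal stream `yᵢ` (laws `μ.withDensity q`); `p ≥ 0` measurable, integrable, `∫ p dμ = 1`;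
`q > 0` measurable, integrable; weights printed with ANY normalisation `w̃ = c·p/q`, `c > 0`.  Then
almost surely the printed ratio
`Rₙ = (Σ_{i ≠ j < n} min(w̃ᵢ, w̃ⱼ)/(n(n − 1))) / (Σ_{j<n} w̃ⱼ/n) → acc(p, q)` — no second weight
moment (the ESS may be `0`), no ceiling. [ours] -/
theorem printedAcceptance_tendsto_ae (hym : ∀ j, Measurable (y j)) (hind : iIndepFun y P)
    (hlaw : ∀ j, Measure.map (y j) P = μ.withDensity fun z => ENNReal.ofReal (q z))
    (hp0 : ∀ z, 0 ≤ p z) (hpm : Measurable p) (hpi : Integrable p μ) (hp1 : ∫ z, p z ∂μ = 1)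
    (hq0 : ∀ z, 0 < q z) (hqm : Measurable q) (hqi : Integrable q μ) {wt : X → ℝ} {c : ℝ}
    (hc : 0 < c) (hwt : ∀ z, wt z = c * (p z / q z)) :
    ∀ᵐ ω ∂P, Tendsto (fun n : ℕ =>
        ((∑ z ∈ (univ : Finset (Fin n)).offDiag, min (wt (y z.1 ω)) (wt (y z.2 ω)))
            / (n * (n - 1) : ℝ))
          / ((∑ j : Fin n, wt (y j ω)) / n))
      atTop (𝓝 (∫ a, ∫ b, min (p a * q b) (p b * q a) ∂μ ∂μ)) := by
  filter_upwards [allPairsAcceptance_tendsto_ae hym hind hlaw hp0 hpm hpi hq0 hqm hqi,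
    meanWeight_fin_tendsto_one_ae hym hind hlaw hpm hpi hp1 hq0 hqm] with ω hU hW
  have h := hU.div hW one_ne_zero
  rw [div_one] at h
  refine h.congr' (Eventually.of_forall fun n => ?_)
  exact (AllPairsMedian.blockRatio_scale_free hc hwt (fun i : Fin n => y i ω)).symm

end Model

end Summit.Ventures.LatticeQCDFlow.Scoring.CardConsistency

end
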